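import Mathlib
import Summits.NavierStokesRegularity.OSWSelfSimilar.TypeIIInnerLimitViscosity
import Summits.NavierStokesRegularity.OSWSelfSimilar.TypeIIInnerLimitMaster
import HarnessLib
/-!
# The Z1 inner-object MASTER THEOREM at ARBITRARY viscosity ν > 0 (zone Z1 TEMPLATE §T1.4-I; kernel, unconditional)

HONEST FRAMING (cell ns-blowup GROUP B «PROFILE SEARCH», zone Z1; D-0035/D-0074): part XXXIII of the Z1 dictionary. Part XXXII's
`innerObject_master_of_singularity` is stated at `ν = 1`; K8's standing hypotheses in the tree are stated for every `ν > 0`.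
As in part XXVII, the time dilation `v(s, x) = ν⁻¹u(s/ν, x)` (`IsMaximalSmoothSolution.toUnitViscosity`,
`IsLerayHopfOn.viscosityRescale`) transports the master theorem to viscosity `ν`, read in the ν-covariant gauge N-a
(amplitude `λ/ν`, parabolic clock `λ²/ν`): the zoom is `y ↦ (λₖ/ν)u(tₖ + (λₖ²/ν)s, cₖ + λₖy)`, the zoomed vorticity is
`(λₖ²/ν) ω(tₖ + (λₖ²/ν)s, cₖ + λₖy)` and the swirl at the zoom points is read as `ν⁻¹Γ`.

* `curl_const_smul_noDiff`, `curl_timeRescale_slice`, `swirl_timeRescale_slice` — bookkeeping (`curl(a•f) = a•curl f` with no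
  differentiability hypothesis, from the tree's `curl_smul_comp_smul`; curl and swirl of the dilated slices);
* `innerObject_master_of_singularity_viscosity` — **THE MASTER THEOREM AT ANY ν > 0**, every rider on ONE subsequence.

**Nothing here asserts that a singular solution exists or that (AX-L) holds or fails.** «violates: n/a — dictionary»;
bears_on LADDER-NS N5/Z1 → N1 linear core / N0⁻. Author: ns-blowup-profile-eng-1 g8, 2026-08-27.
-/

open Real Filter Topology Set MeasureTheory Function Bornology
open scoped ENNReal NNReal
open Literature.Analysis.FluidPDE

namespace Summit.NavierStokesRegularity.OSWSelfSimilar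
namespace TypeIIModulationDictionary

section MasterViscosity

variable {T ν Mₛ : ℝ} {u : ℝ → EuclideanSpace ℝ (Fin 3) → EuclideanSpace ℝ (Fin 3)}
  {p : ℝ → EuclideanSpace ℝ (Fin 3) → ℝ}

/-- `curl (a • f) = a • curl f` pointwise, with NO differentiability hypothesis (the tree's `curl_smul_comp_smul` at
dilation factor `1`). [new here — elementary] -/
theorem curl_const_smul_noDiff (f : EuclideanSpace ℝ (Fin 3) → EuclideanSpace ℝ (Fin 3)) (a : ℝ)
    (x : EuclideanSpace ℝ (Fin 3)) : curl (fun y => a • f y) x = a • curl f x := by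
  have h := curl_smul_comp_smul f a 1 x
  simpa only [one_smul, mul_one] using h

/-- Curl of the dilated slice: `curl(ν⁻¹u(ν⁻¹τ))(x) = ν⁻¹ (curl u(ν⁻¹τ))(x)`. [new here — bookkeeping] -/
theorem curl_timeRescale_slice (ν τ : ℝ) (x : EuclideanSpace ℝ (Fin 3)) :
    curl (timeRescale ν⁻¹ ν⁻¹ u τ) x = ν⁻¹ • curl (u (ν⁻¹ * τ)) x := by
  rw [timeRescale_slice]
  exact curl_const_smul_noDiff _ _ _

/-- Swirl of the dilated slice: `Γ(ν⁻¹u(ν⁻¹τ))(x) = ν⁻¹ Γ(u(ν⁻¹τ))(x)`. [new here — bookkeeping] -/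
theorem swirl_timeRescale_slice (ν τ : ℝ) (x : EuclideanSpace ℝ (Fin 3)) :
    swirl (timeRescale ν⁻¹ ν⁻¹ u τ) x = ν⁻¹ * swirl (u (ν⁻¹ * τ)) x := by
  rw [timeRescale_slice]
  simp only [swirl, PiLp.smul_apply, smul_eq_mul]
  ring

/-- **THE Z1 INNER-OBJECT MASTER THEOREM AT ARBITRARY VISCOSITY ν > 0 (unconditional; every rider on ONE subsequence).**
Let `(u, p)` be a maximal smooth unforced solution AT VISCOSITY ν (`IsMaximalSmoothSolution ν 0 u p T⋆`, `T⋆ > 0`),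
Leray–Hopf on `[0, T⋆)` at viscosity ν from `u 0`, bounded on every closed sub-slab, with axisymmetric slices and
`|Γ(0, ·)| ≤ Mₛ`. Then there are gauge N-a zoom data `tₖ ∈ [T⋆/2, T⋆)`, `λₖ > 0 → 0`, centres `cₖ`, with the ν-covariant
normalisation `(λₖ/ν)‖u‖ ≤ 1` on `[0, tₖ]`, and ONE subsequence `φ` along which the zoom
`y ↦ (λₖ/ν)u(tₖ + (λₖ²/ν)s, cₖ + λₖy)` converges slice-wise locally uniformly to a KNSS blow-up limit `W` (unit viscosity;
with the Oseen identity) AND the zoomed vorticity `(λₖ²/ν)(curl u(tₖ + (λₖ²/ν)s))(cₖ + λₖy) → curl W(s)(y)` pointwise, with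
EXACTLY ONE of
(α) `W ≡ c`, `‖c‖ = 1`, `c₁ = 0`, zoomed vorticity `→ 0` everywhere; or
(β) centres on the axis, `W` refutes `AxisymmetricLiouvilleBoundedSwirl` (axisymmetric slices, `|Γ_W| ≤ Mₛ/ν`, a
non-constant slice), `curl W ≠ 0` somewhere, swirl present with concentration `ν⁻¹Γ(tₖ + (λₖ²/ν)s, cₖ + λₖy) → Γ_W(s,y) ≠ 0`,
`r‖W_pol‖` and `r‖W_pol − c e_z‖` unbounded, `Γ_W ∉ L^∞_sL^q`, `Γ_W` non-decaying, `Γ_W` not at the LRZ rate. Part XXXII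
applied to `v = ν⁻¹u(ν⁻¹ ·)` and read back. [new here — dictionary; unconditional, any ν > 0] -/
theorem innerObject_master_of_singularity_viscosity (hν : 0 < ν) (hT : 0 < T)
    (hmax : IsMaximalSmoothSolution ν 0 u p T) (hLH : IsLerayHopfOn T ν 0 (u 0) u)
    (hbdd : ∀ S < T, ∃ N : ℝ, 0 < N ∧ ∀ t ∈ Icc 0 S, ∀ x, ‖u t x‖ ≤ N)
    (haxi : ∀ t, IsAxisymmetric (u t)) (hMₛ : ∀ x, |swirl (u 0) x| ≤ Mₛ) :
    ∃ (tn lamn : ℕ → ℝ) (cn : ℕ → EuclideanSpace ℝ (Fin 3)) (φ : ℕ → ℕ)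
      (W : ℝ → EuclideanSpace ℝ (Fin 3) → EuclideanSpace ℝ (Fin 3)),
      (∀ k, T / 2 ≤ tn k ∧ tn k < T) ∧ (∀ k, 0 < lamn k) ∧ Tendsto lamn atTop (𝓝 0) ∧
      (∀ k, ∀ t ∈ Icc 0 (tn k), ∀ x, lamn k / ν * ‖u t x‖ ≤ 1) ∧ StrictMono φ ∧ IsKNSSBlowupLimit W ∧
      (∀ s < 0, TendstoLocallyUniformly
        (fun k => ((lamn (φ k) / ν) • stPull (lamn (φ k) ^ 2 / ν) (lamn (φ k)) (tn (φ k)) (cn (φ k)) u) s)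
          (W s) atTop) ∧
      (∀ s t : ℝ, s < t → t < 0 → ∀ x,
        W t x = Literature.Analysis.UnboundedOperators.heatExtension (W s) (t - s) x - oseenDuhamel 1 s W W t x) ∧
      (∀ s < 0, ∀ y : EuclideanSpace ℝ (Fin 3), Tendsto (fun j => (lamn (φ j) ^ 2 / ν) •
        curl (u (tn (φ j) + lamn (φ j) ^ 2 / ν * s)) (cn (φ j) + lamn (φ j) • y)) atTop (𝓝 (curl (W s) y))) ∧
      (((∃ c : EuclideanSpace ℝ (Fin 3), ‖c‖ = 1 ∧ c 1 = 0 ∧ ∀ s < 0, ∀ y : EuclideanSpace ℝ (Fin 3), W s y = c) ∧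
          ∀ s < 0, ∀ y : EuclideanSpace ℝ (Fin 3), Tendsto (fun j => (lamn (φ j) ^ 2 / ν) •
            curl (u (tn (φ j) + lamn (φ j) ^ 2 / ν * s)) (cn (φ j) + lamn (φ j) • y)) atTop (𝓝 0)) ∨
        ((∀ k, cn k 0 = 0 ∧ cn k 1 = 0) ∧
          ¬ Summit.NavierStokesRegularity.NavierStokesRegularity.AxisymmetricLiouvilleBoundedSwirl ∧
          (∀ s < 0, IsAxisymmetric (W s)) ∧ (∀ s < 0, ∀ y : EuclideanSpace ℝ (Fin 3), |swirl (W s) y| ≤ Mₛ / ν) ∧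
          (∃ s < 0, ∃ x : EuclideanSpace ℝ (Fin 3), W s x ≠ W s 0) ∧
          (∃ s < 0, ∃ y : EuclideanSpace ℝ (Fin 3), curl (W s) y ≠ 0) ∧
          (∃ s < 0, ∃ y : EuclideanSpace ℝ (Fin 3), swirl (W s) y ≠ 0 ∧
            Tendsto (fun k => ν⁻¹ * swirl (u (tn (φ k) + lamn (φ k) ^ 2 / ν * s)) (cn (φ k) + lamn (φ k) • y)) atTop
              (𝓝 (swirl (W s) y))) ∧
          (∀ C : ℝ, ∃ s < 0, ∃ x : EuclideanSpace ℝ (Fin 3), C < cylRadius x * ‖poloidalPart (W s) x‖) ∧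
          (∀ c C : ℝ, ∃ s < 0, ∃ x : EuclideanSpace ℝ (Fin 3), C < cylRadius x * ‖poloidalPart (W s) x - c • eZ‖) ∧
          (∀ q : ℝ≥0∞, 1 ≤ q → q < ⊤ → ∀ K : ℝ≥0, ∃ s < 0, (K : ℝ≥0∞) < eLpNorm (swirl (W s)) q volume) ∧
          (∃ ε : ℝ, 0 < ε ∧ ∀ R : ℝ, ∃ s < 0, ∃ x : EuclideanSpace ℝ (Fin 3),
            R ≤ cylRadius x ∧ ε < |swirl (W s) x|) ∧
          ∃ ε₀ ∈ Set.Ioo (0 : ℝ) 1, ∀ L R₀ : ℝ, ∃ s < 0, ∃ x : EuclideanSpace ℝ (Fin 3),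
            R₀ ≤ cylRadius x ∧ ε₀ * L ^ 2 / cylRadius x < |swirl (W s) x ^ 2 - L ^ 2|)) := by
  -- the unit-viscosity dilation and its standing hypotheses (as in part XXVII)
  set v : ℝ → EuclideanSpace ℝ (Fin 3) → EuclideanSpace ℝ (Fin 3) := timeRescale ν⁻¹ ν⁻¹ u with hv
  have hνT : 0 < ν * T := mul_pos hν hT
  have hmax' : IsMaximalSmoothSolution 1 0 v (timeRescale ν⁻¹ (ν⁻¹ ^ 2) p) (ν * T) := hmax.toUnitViscosity hν
  have hv0 : v 0 = ν⁻¹ • u 0 := by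
    funext x
    simp [hv, timeRescale_apply]
  have hLH' : IsLerayHopfOn (ν * T) 1 0 (v 0) v := by
    have h := hLH.viscosityRescale (inv_pos.2 hν)
    rw [inv_mul_cancel₀ hν.ne', timeRescale_zero_force, div_inv_eq_mul, mul_comm T ν] at h
    rwa [hv0]
  have hbdd' := bounded_subslab_timeRescale (u := u) hν hbdd
  have haxi' : ∀ t, IsAxisymmetric (v t) := fun t => isAxisymmetric_timeRescale haxi _ _ t
  have hMₛ' : ∀ x, |swirl (v 0) x| ≤ Mₛ / ν := fun x => by
    have h := swirl_timeRescale_zero (u := u) hMₛ ν⁻¹ ν⁻¹ x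
    rwa [abs_of_pos (inv_pos.2 hν), inv_mul_eq_div] at h
  obtain ⟨tn', lamn, cn, φ, W, htn', hlam, hlam0, hgauge', hφ, hW, hconv', hmild, hcurl', halt⟩ :=
    innerObject_master_of_singularity hνT hmax' hLH' hbdd' haxi' hMₛ'
  -- dictionary of times: tₖ = ν⁻¹ tₖ'
  have htime : ∀ k (s : ℝ), ν⁻¹ * (tn' (φ k) + lamn (φ k) ^ 2 * s) =
      ν⁻¹ * tn' (φ k) + lamn (φ k) ^ 2 / ν * s := fun k s => by ring
  -- the zoomed vorticity of `v` is the ν-covariant zoomed vorticity of `u`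
  have hcurl : ∀ s < 0, ∀ y : EuclideanSpace ℝ (Fin 3), Tendsto (fun j => (lamn (φ j) ^ 2 / ν) •
      curl (u (ν⁻¹ * tn' (φ j) + lamn (φ j) ^ 2 / ν * s)) (cn (φ j) + lamn (φ j) • y)) atTop (𝓝 (curl (W s) y)) := by
    intro s hs y
    refine (hcurl' s hs y).congr fun j => ?_
    rw [hv, curl_timeRescale_slice, smul_smul, htime, div_eq_mul_inv, mul_comm (lamn (φ j) ^ 2) ν⁻¹]
  refine ⟨fun k => ν⁻¹ * tn' k, lamn, cn, φ, W, fun k => ⟨?_, ?_⟩, hlam, hlam0, fun k t ht x => ?_, hφ, hW,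
    fun s hs => ?_, hmild, hcurl, ?_⟩
  · have h := (htn' k).1
    rw [le_inv_mul_iff₀' hν]; linarith
  · have h := (htn' k).2
    rw [inv_mul_lt_iff₀ hν]; linarith [mul_comm ν T]
  · have hνt : ν * t ∈ Icc 0 (tn' k) := by
      refine ⟨mul_nonneg hν.le ht.1, ?_⟩
      have := ht.2
      rw [le_inv_mul_iff₀' hν] at this
      linarith [mul_comm ν t]
    have h := hgauge' k (ν * t) hνt x
    rw [hv, timeRescale_apply, ← mul_assoc, inv_mul_cancel₀ hν.ne', one_mul, norm_smul, Real.norm_eq_abs,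
      abs_of_pos (inv_pos.2 hν)] at h
    calc lamn k / ν * ‖u t x‖ = lamn k * (ν⁻¹ * ‖u t x‖) := by ring
      _ ≤ 1 := h
  · refine (hconv' s hs).congr fun k => ?_
    rw [hv, zoom_timeRescale]
    intro x
    rfl
  · rcases halt with ⟨hc, hzero⟩ | ⟨hax0, hnot, hax, hsw, hnc, hcurlne, ⟨s, hs, y, hy, hswirl⟩, hrest⟩
    · refine Or.inl ⟨hc, fun s hs y => ?_⟩
      refine (hzero s hs y).congr fun j => ?_
      rw [hv, curl_timeRescale_slice, smul_smul, htime, div_eq_mul_inv, mul_comm (lamn (φ j) ^ 2) ν⁻¹]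
    · refine Or.inr ⟨hax0, hnot, hax, hsw, hnc, hcurlne, ⟨s, hs, y, hy, ?_⟩, hrest⟩
      refine hswirl.congr fun k => ?_
      rw [hv, swirl_timeRescale_slice, htime]

end MasterViscosity

end TypeIIModulationDictionary
end Summit.NavierStokesRegularity.OSWSelfSimilar
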